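import Summits.HodgeConjecture.HodgeConjecture.Theorems.F0P3cStCharTSShfOfSurj          -- ★ p849631 «SHF-RED★» (this seat): (SURJ) ⟹ (SHF′); brings ★ p849538 ShellFn, ★ p849400 TorusRay, ★ p849333 TorusCompactPart
import Literature.Topology.LocallyConstantCompactSupportUniform                         -- ★ uniform local constancy `exists_forall_mul_eq_of_hasCompactSupport_of_basis` (BZ §1.1)
import Literature.NumberTheory.Rogawski1990.LocalTransferGlue                            -- ★ `IsLocSmooth.finset_sum`
import HarnessLib

/-!
# F0 · P3c · line LH6 «StCharTS» — «SURJ-HECKE★» (H4) + ASSEMBLY: (SURJ) FROM THE SHELL TRANSFORMS `F_{𝟙_{K_n a K_n}} = κ·(𝟙_{aC_n} + 𝟙_{ω(aC_n)})`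
# [Rogawski1990, §12.7 L. 12.7.1 (proof) p. 191 «there exists `f ∈ S` such that `F_f` has support in `η^m𝒪^* ∪ η^{−m}𝒪^*`»; L. 12.7.2 (proof) p. 194]

Cell `pub/hodgecm-mathlib`, crux H413 = `stmt-HodgeConjecture-24833` (`--supports` lane, helper), route HCCMUnconditional; seat LH6-p05 (g2); desk F0P3b-plan (g23)
05:49:42Z «SURJ-HECKE★ ADOPTED as the (SURJ) road» (print's own route: Hecke functions, no submersion ∕ quotient-measure topology).  THEOREMS ONLY, sorry-free,
no definition ∕ instance ∕ notation ∕ named fact.  OBJECTS (inline terms of record): `M := (UnitaryGroup.LocalRing L v)ˣ × ↥(normOneUnits (conjLocal L c v))`,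
`M_c = 𝒪_vˣ × E¹_v` (★ p849333), `ω(u, z) = (σ(u)⁻¹, z)` (★ p849140); «dominant `u`» := `∀ w, |u.1_w|_w < 1`.
* §1 (H4) TORUS SIDE (non-split `v`): `dominant_or_mem_or_dominant_reflect` (trichotomy dominant ∕ `∈ M_c` ∕ `ω`-dominant), the exclusivities, dominance is
  constant on the cosets of any `C ≤ M_c`, and **`exists_finset_shell_decomposition`**: for an OPEN subgroup `C ≤ M_c`, every `C`-invariant, `ω`-symmetric,
  compactly supported `F : M → ℂ` vanishing on `M_c` is a FINITE combination `F = Σ_{u ∈ s} F(u)·(𝟙_{uC} + 𝟙_{uC}∘ω)` over DOMINANT representatives `u`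
  (finite subcover of `tsupport F` by cosets; representatives through `M ⧸ C` and `Quotient.out`; the `ω`-pairs `{uC, ω(u)C}`).
* §2 ASSEMBLY **`surj_of_shells`**: for ANY `Ftr`, `Ω` and ANY family of open subgroups `C n ≤ M_c` entering every neighbourhood of `1`: IF every dominant `u` and
  level `n` has a smooth `φ` supported in `Ω` with `Ftr φ = κ·(𝟙_{uC_n} + 𝟙_{uC_n}∘ω)`, `κ ≠ 0` (the SHELL TRANSFORM — road (D) D3-ii-G for `φ = 𝟙_{K_n ι(u) K_n}`, LH2-p03 (g3),
  with «HYP-SET★» F0P3a-p05 (g19) for the support), and `Ftr` is additive-homogeneous on finite sums of smooth functions (★ `classOrbitalIntegral_finset_sum_of_isLocSmooth`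
  at the regular classes for `torusTransform`), THEN (SURJ) of ★ p849631 holds: every smooth `ω`-symmetric `F` vanishing on `M_c` is `Ftr φ` for a smooth `φ` supported in
  `Ω` — (H3) uniform local constancy is ★ `Literature.Topology.exists_forall_mul_eq_of_hasCompactSupport_of_basis`.  With ★ p849631 `shf_of_surj`: (SHF′) of the (TOR)
  package follows — **`shf_of_shells`**.
HONEST LABEL: HC_CM is proved only modulo the 7 printed citations (2 remaining: hLiu418 = stmt-HodgeConjecture-24832, h413 = stmt-HodgeConjecture-24833) until rung 0
closes; count-neutral (the shell-transform input `hshell` and the additivity `hlin` are BINDERS here, discharged in the next file at the named terms of ★ p849564 once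
D3-ii-G (every dominant `a`, every level `n`) is ★).

## References
* [Rogawski1990] J. D. Rogawski, *Automorphic Representations of Unitary Groups in Three Variables*, Ann. of Math. Stud. 123 (1990): §12.7 L. 12.7.1 (proof) p. 191,
  L. 12.7.2 (proof) pp. 193–194; §4.9 p. 54 (orbital integrals); §12.2 p. 173.
* [BernsteinZelevinsky1976] I. N. Bernstein, A. V. Zelevinsky, *Representations of the group GL(n,F) where F is a non-archimedean local field*, Russian Math. Surveys 31
  (1976), §1.1 (locally constant compactly supported functions are uniformly locally constant).
-/

set_option autoImplicit false
-- the mandated namespace has the single-problem summit's repeated segment (`HodgeConjecture.HodgeConjecture`)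
set_option linter.dupNamespace false

noncomputable section

open NumberField IsDedekindDomain MeasureTheory Measure Topology Filter
open scoped NNReal ENNReal Pointwise
open Literature.NumberTheory.Rogawski1990 Literature.NumberTheory.Automorphic Literature.NumberTheory.Automorphic.UnitaryGroup

namespace Summit.HodgeConjecture.HodgeConjecture.Cruxes.H413.F0P3cStCharTSSurjHecke

variable (L : Type) [Field L] [NumberField L] [IsCMField L] (v : HeightOneSpectrum (𝓞 ↥(maximalRealSubfield L)))

/-! ## §1 (H4) The torus side: dominant representatives and the finite shell decomposition -/

/-- Valuations of the components of a product of units: `|(u·c)_w|_w = |u_w|_w·|c_w|_w`. [folklore] -/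
theorem valued_fst_mul_apply (u c : ((UnitaryGroup.LocalRing L v)ˣ × ↥(normOneUnits (conjLocal L (IsCMField.complexConj L) v)))) (w : PlacesOver L v) :
    Valued.v (((u * c).1 : UnitaryGroup.LocalRing L v) w) = Valued.v ((u.1 : UnitaryGroup.LocalRing L v) w) * Valued.v ((c.1 : UnitaryGroup.LocalRing L v) w) := by
  rw [Prod.fst_mul, Units.val_mul, Pi.mul_apply, map_mul]

/-- An element of `M_c` has `|u_w|_w = 1` at every `w` (★ `mem_unitsIntegers_iff`). [cite: Rogawski1990, §12.2 p. 173] -/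
theorem valued_fst_apply_eq_one_of_mem {c : ((UnitaryGroup.LocalRing L v)ˣ × ↥(normOneUnits (conjLocal L (IsCMField.complexConj L) v)))} (hc : c ∈ (((Submonoid.pi Set.univ (fun w : PlacesOver L v => (w.1.adicCompletionIntegers L).toSubring.toSubmonoid)).units.prod (⊤ : Subgroup ↥(normOneUnits (conjLocal L (IsCMField.complexConj L) v)))) : Subgroup ((UnitaryGroup.LocalRing L v)ˣ × ↥(normOneUnits (conjLocal L (IsCMField.complexConj L) v))))) (w : PlacesOver L v) :
    Valued.v ((c.1 : UnitaryGroup.LocalRing L v) w) = 1 :=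
  (F0P3cStCharTSTorusCompactPart.mem_unitsIntegers_iff L v _).1 (Subgroup.mem_prod.1 hc).1 w

/-- **Dominance is constant on the cosets of a subgroup `C ≤ M_c`**: `|(u·c)_w| = |u_w|` for `c ∈ C`. [cite: Rogawski1990, §12.7 L. 12.7.1 (proof) p. 191] -/
theorem dominant_mul_iff {C : Subgroup ((UnitaryGroup.LocalRing L v)ˣ × ↥(normOneUnits (conjLocal L (IsCMField.complexConj L) v)))} (hCle : C ≤ (((Submonoid.pi Set.univ (fun w : PlacesOver L v => (w.1.adicCompletionIntegers L).toSubring.toSubmonoid)).units.prod (⊤ : Subgroup ↥(normOneUnits (conjLocal L (IsCMField.complexConj L) v)))) : Subgroup ((UnitaryGroup.LocalRing L v)ˣ × ↥(normOneUnits (conjLocal L (IsCMField.complexConj L) v))))) (u : ((UnitaryGroup.LocalRing L v)ˣ × ↥(normOneUnits (conjLocal L (IsCMField.complexConj L) v)))) {c : ((UnitaryGroup.LocalRing L v)ˣ × ↥(normOneUnits (conjLocal L (IsCMField.complexConj L) v)))} (hc : c ∈ C) :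
    (∀ w : PlacesOver L v, Valued.v (((u * c).1 : UnitaryGroup.LocalRing L v) w) < 1) ↔
      ∀ w : PlacesOver L v, Valued.v ((u.1 : UnitaryGroup.LocalRing L v) w) < 1 := by
  refine forall_congr' fun w => ?_
  rw [valued_fst_mul_apply, valued_fst_apply_eq_one_of_mem L v (hCle hc) w, mul_one]

/-- Dominance along a coset: `m ∈ u • C` (`C ≤ M_c`) is dominant iff `u` is. [cite: Rogawski1990, §12.7 L. 12.7.1 (proof) p. 191] -/
theorem dominant_iff_of_mem_smul {C : Subgroup ((UnitaryGroup.LocalRing L v)ˣ × ↥(normOneUnits (conjLocal L (IsCMField.complexConj L) v)))} (hCle : C ≤ (((Submonoid.pi Set.univ (fun w : PlacesOver L v => (w.1.adicCompletionIntegers L).toSubring.toSubmonoid)).units.prod (⊤ : Subgroup ↥(normOneUnits (conjLocal L (IsCMField.complexConj L) v)))) : Subgroup ((UnitaryGroup.LocalRing L v)ˣ × ↥(normOneUnits (conjLocal L (IsCMField.complexConj L) v))))) {u m : ((UnitaryGroup.LocalRing L v)ˣ × ↥(normOneUnits (conjLocal L (IsCMField.complexConj L) v)))} (hm : m ∈ u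 • (C : Set ((UnitaryGroup.LocalRing L v)ˣ × ↥(normOneUnits (conjLocal L (IsCMField.complexConj L) v))))) :
    (∀ w : PlacesOver L v, Valued.v ((m.1 : UnitaryGroup.LocalRing L v) w) < 1) ↔
      ∀ w : PlacesOver L v, Valued.v ((u.1 : UnitaryGroup.LocalRing L v) w) < 1 := by
  obtain ⟨c, hc, rfl⟩ := hm
  exact dominant_mul_iff L v hCle u hc

/-- A dominant element is not in `M_c`. [cite: Rogawski1990, §12.7 L. 12.7.1 (proof) p. 191] -/
theorem not_mem_of_dominant {m : ((UnitaryGroup.LocalRing L v)ˣ × ↥(normOneUnits (conjLocal L (IsCMField.complexConj L) v)))} (hd : ∀ w : PlacesOver L v, Valued.v ((m.1 : UnitaryGroup.LocalRing L v) w) < 1) : m ∉ (((Submonoid.pi Set.univ (fun w : PlacesOver L v => (w.1.adicCompletionIntegers L).toSubring.toSubmonoid)).units.prod (⊤ : Subgroup ↥(normOneUnits (conjLocal L (IsCMField.complexConj L) v)))) : Subgroup ((UnitaryGroup.LocalRing L v)ˣ × ↥(normOneUnits (conjLocal L (IsCMField.complexConj L) v)))) := by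
  obtain ⟨w⟩ := (inferInstance : Nonempty (PlacesOver L v))
  exact fun hm => (hd w).ne (valued_fst_apply_eq_one_of_mem L v hm w)

/-- **`m` and `ω m` are never both dominant** (non-split `v`: `|(ω m).1_w| = |m.1_w|⁻¹`, ★ `valued_fst_reflect_apply`). [cite: Rogawski1990, §12.2 p. 173] -/
theorem not_dominant_reflect_of_dominant (hns : ∀ w : PlacesOver L v, IsCMField.complexConj L • w.1 = w.1) {m : ((UnitaryGroup.LocalRing L v)ˣ × ↥(normOneUnits (conjLocal L (IsCMField.complexConj L) v)))}
    (hd : ∀ w : PlacesOver L v, Valued.v ((m.1 : UnitaryGroup.LocalRing L v) w) < 1) :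
    ¬ ∀ w : PlacesOver L v, Valued.v ((((fun p : ((UnitaryGroup.LocalRing L v)ˣ × ↥(normOneUnits (conjLocal L (IsCMField.complexConj L) v))) => ((Units.map ((conjLocal L (IsCMField.complexConj L) v : UnitaryGroup.LocalRing L v →+* UnitaryGroup.LocalRing L v) : UnitaryGroup.LocalRing L v →* UnitaryGroup.LocalRing L v) p.1)⁻¹, p.2)) m).1 : UnitaryGroup.LocalRing L v) w) < 1 := by
  obtain ⟨w⟩ := (inferInstance : Nonempty (PlacesOver L v))
  intro h
  have h1 := h w
  rw [F0P3cStCharTSShellFn.valued_fst_reflect_apply L v hns m w] at h1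
  have hne : Valued.v ((m.1 : UnitaryGroup.LocalRing L v) w) ≠ 0 := (Valuation.ne_zero_iff _).2 (F0P3cStCharTSTorusRay.coe_apply_ne_zero L v _ w)
  exact (lt_asymm (hd w)) ((inv_lt_one₀ (zero_lt_iff.2 hne)).1 h1)

/-- **TRICHOTOMY at a non-split `v`**: every `m ∈ M` is dominant, or in `M_c`, or `ω`-dominant (one place `w` above `v`: `|m.1_w| < 1`, `= 1`, or `> 1`).
[cite: Rogawski1990, §12.7 L. 12.7.2 (proof) p. 193; §12.2 p. 173] -/
theorem dominant_or_mem_or_dominant_reflect (hns : ∀ w : PlacesOver L v, IsCMField.complexConj L • w.1 = w.1) (m : ((UnitaryGroup.LocalRing L v)ˣ × ↥(normOneUnits (conjLocal L (IsCMField.complexConj L) v)))) :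
    (∀ w : PlacesOver L v, Valued.v ((m.1 : UnitaryGroup.LocalRing L v) w) < 1) ∨ m ∈ (((Submonoid.pi Set.univ (fun w : PlacesOver L v => (w.1.adicCompletionIntegers L).toSubring.toSubmonoid)).units.prod (⊤ : Subgroup ↥(normOneUnits (conjLocal L (IsCMField.complexConj L) v)))) : Subgroup ((UnitaryGroup.LocalRing L v)ˣ × ↥(normOneUnits (conjLocal L (IsCMField.complexConj L) v)))) ∨
      ∀ w : PlacesOver L v, Valued.v ((((fun p : ((UnitaryGroup.LocalRing L v)ˣ × ↥(normOneUnits (conjLocal L (IsCMField.complexConj L) v))) => ((Units.map ((conjLocal L (IsCMField.complexConj L) v : UnitaryGroup.LocalRing L v →+* UnitaryGroup.LocalRing L v) : UnitaryGroup.LocalRing L v →* UnitaryGroup.LocalRing L v) p.1)⁻¹, p.2)) m).1 : UnitaryGroup.LocalRing L v) w) < 1 := by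
  obtain ⟨w₀⟩ := (inferInstance : Nonempty (PlacesOver L v))
  haveI := PlacesOver.subsingleton_of_smul_eq (IsCMField.complexConj L) (IsCMField.complexConj_ne_one L) w₀ (hns w₀)
  rcases lt_trichotomy (Valued.v ((m.1 : UnitaryGroup.LocalRing L v) w₀)) 1 with h | h | h
  · exact Or.inl fun w => by rw [Subsingleton.elim w w₀]; exact h
  · refine Or.inr (Or.inl (Subgroup.mem_prod.2 ⟨(F0P3cStCharTSTorusCompactPart.mem_unitsIntegers_iff L v _).2 fun w => ?_, Subgroup.mem_top _⟩))
    rw [Subsingleton.elim w w₀]; exact h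
  · refine Or.inr (Or.inr fun w => ?_)
    rw [F0P3cStCharTSShellFn.valued_fst_reflect_apply L v hns m w, Subsingleton.elim w w₀]
    have hpos : 0 < Valued.v ((m.1 : UnitaryGroup.LocalRing L v) w₀) := lt_trans zero_lt_one h
    exact (inv_lt_one₀ hpos).2 h

/-- Coset membership through the quotient: `m ∈ u • C ↔ [u] = [m]` in `M ⧸ C`. [folklore] -/
theorem mem_smul_iff_mk_eq (C : Subgroup ((UnitaryGroup.LocalRing L v)ˣ × ↥(normOneUnits (conjLocal L (IsCMField.complexConj L) v)))) (u m : ((UnitaryGroup.LocalRing L v)ˣ × ↥(normOneUnits (conjLocal L (IsCMField.complexConj L) v)))) : m ∈ u • (C : Set ((UnitaryGroup.LocalRing L v)ˣ × ↥(normOneUnits (conjLocal L (IsCMField.complexConj L) v)))) ↔ (QuotientGroup.mk u : ((UnitaryGroup.LocalRing L v)ˣ × ↥(normOneUnits (conjLocal L (IsCMField.complexConj L) v))) ⧸ C) = QuotientGroup.mk m := by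
  rw [mem_leftCoset_iff, SetLike.mem_coe, QuotientGroup.eq]

/-- The representative `out [m]` lies in the coset `m • C`, i.e. `m ∈ out [m] • C`. [folklore] -/
theorem mem_out_mk_smul (C : Subgroup ((UnitaryGroup.LocalRing L v)ˣ × ↥(normOneUnits (conjLocal L (IsCMField.complexConj L) v)))) (m : ((UnitaryGroup.LocalRing L v)ˣ × ↥(normOneUnits (conjLocal L (IsCMField.complexConj L) v)))) : m ∈ (Quotient.out (QuotientGroup.mk m : ((UnitaryGroup.LocalRing L v)ˣ × ↥(normOneUnits (conjLocal L (IsCMField.complexConj L) v))) ⧸ C)) • (C : Set ((UnitaryGroup.LocalRing L v)ˣ × ↥(normOneUnits (conjLocal L (IsCMField.complexConj L) v)))) := by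
  rw [mem_smul_iff_mk_eq, QuotientGroup.out_eq']

open scoped Classical in
/-- **(H4) THE FINITE SHELL DECOMPOSITION.**  At a non-split `v`, let `C ≤ M_c` be an OPEN subgroup and `F : M → ℂ` be right-`C`-invariant, `ω`-symmetric, zero on
`M_c`, with compact support.  Then there is a finite set `s` of DOMINANT elements with `F = Σ_{u ∈ s} F(u)·(𝟙_{uC} + 𝟙_{uC}∘ω)` — the decomposition of print's
`φ(α) + φ(ᾱ⁻¹)` into symmetrised SMALL-SHELL indicators (each the transform of ONE Hecke function `𝟙_{K_n a K_n}`).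
[cite: Rogawski1990, §12.7 L. 12.7.1 (proof) p. 191; L. 12.7.2 (proof) p. 194] -/
theorem exists_finset_shell_decomposition (hns : ∀ w : PlacesOver L v, IsCMField.complexConj L • w.1 = w.1)
    (C : Subgroup ((UnitaryGroup.LocalRing L v)ˣ × ↥(normOneUnits (conjLocal L (IsCMField.complexConj L) v)))) (hCo : IsOpen (C : Set ((UnitaryGroup.LocalRing L v)ˣ × ↥(normOneUnits (conjLocal L (IsCMField.complexConj L) v))))) (hCle : C ≤ (((Submonoid.pi Set.univ (fun w : PlacesOver L v => (w.1.adicCompletionIntegers L).toSubring.toSubmonoid)).units.prod (⊤ : Subgroup ↥(normOneUnits (conjLocal L (IsCMField.complexConj L) v)))) : Subgroup ((UnitaryGroup.LocalRing L v)ˣ × ↥(normOneUnits (conjLocal L (IsCMField.complexConj L) v)))))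
    {F : ((UnitaryGroup.LocalRing L v)ˣ × ↥(normOneUnits (conjLocal L (IsCMField.complexConj L) v))) → ℂ} (hFC : ∀ m : ((UnitaryGroup.LocalRing L v)ˣ × ↥(normOneUnits (conjLocal L (IsCMField.complexConj L) v))), ∀ c ∈ C, F (m * c) = F m) (hFω : ∀ m : ((UnitaryGroup.LocalRing L v)ˣ × ↥(normOneUnits (conjLocal L (IsCMField.complexConj L) v))), F ((fun p : ((UnitaryGroup.LocalRing L v)ˣ × ↥(normOneUnits (conjLocal L (IsCMField.complexConj L) v))) => ((Units.map ((conjLocal L (IsCMField.complexConj L) v : UnitaryGroup.LocalRing L v →+* UnitaryGroup.LocalRing L v) : UnitaryGroup.LocalRing L v →* UnitaryGroup.LocalRing L v) p.1)⁻¹, p.2)) m) = F m)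
    (hF0 : ∀ m ∈ (((Submonoid.pi Set.univ (fun w : PlacesOver L v => (w.1.adicCompletionIntegers L).toSubring.toSubmonoid)).units.prod (⊤ : Subgroup ↥(normOneUnits (conjLocal L (IsCMField.complexConj L) v)))) : Subgroup ((UnitaryGroup.LocalRing L v)ˣ × ↥(normOneUnits (conjLocal L (IsCMField.complexConj L) v)))), F m = 0) (hFs : HasCompactSupport F) :
    ∃ s : Finset ((UnitaryGroup.LocalRing L v)ˣ × ↥(normOneUnits (conjLocal L (IsCMField.complexConj L) v))), (∀ u ∈ s, ∀ w : PlacesOver L v, Valued.v ((u.1 : UnitaryGroup.LocalRing L v) w) < 1) ∧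
      ∀ m : ((UnitaryGroup.LocalRing L v)ˣ × ↥(normOneUnits (conjLocal L (IsCMField.complexConj L) v))), F m = ∑ u ∈ s, F u * ((u • (C : Set ((UnitaryGroup.LocalRing L v)ˣ × ↥(normOneUnits (conjLocal L (IsCMField.complexConj L) v))))).indicator (fun _ => (1 : ℂ)) m + (u • (C : Set ((UnitaryGroup.LocalRing L v)ˣ × ↥(normOneUnits (conjLocal L (IsCMField.complexConj L) v))))).indicator (fun _ => (1 : ℂ)) ((fun p : ((UnitaryGroup.LocalRing L v)ˣ × ↥(normOneUnits (conjLocal L (IsCMField.complexConj L) v))) => ((Units.map ((conjLocal L (IsCMField.complexConj L) v : UnitaryGroup.LocalRing L v →+* UnitaryGroup.LocalRing L v) : UnitaryGroup.LocalRing L v →* UnitaryGroup.LocalRing L v) p.1)⁻¹, p.2)) m)) := by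
  -- a finite subcover of the support by cosets
  obtain ⟨t, ht⟩ := hFs.elim_finite_subcover (fun m : ((UnitaryGroup.LocalRing L v)ˣ × ↥(normOneUnits (conjLocal L (IsCMField.complexConj L) v))) => m • (C : Set ((UnitaryGroup.LocalRing L v)ˣ × ↥(normOneUnits (conjLocal L (IsCMField.complexConj L) v))))) (fun m => hCo.smul m)
    (fun m _ => Set.mem_iUnion.2 ⟨m, by rw [mem_leftCoset_iff, inv_mul_cancel]; exact C.one_mem⟩)
  -- dominant representatives of the classes met
  let s : Finset ((UnitaryGroup.LocalRing L v)ˣ × ↥(normOneUnits (conjLocal L (IsCMField.complexConj L) v))) := ((t.image (fun m : ((UnitaryGroup.LocalRing L v)ˣ × ↥(normOneUnits (conjLocal L (IsCMField.complexConj L) v))) => (QuotientGroup.mk m : ((UnitaryGroup.LocalRing L v)ˣ × ↥(normOneUnits (conjLocal L (IsCMField.complexConj L) v))) ⧸ C))).image Quotient.out).filter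
    (fun u => ∀ w : PlacesOver L v, Valued.v ((u.1 : UnitaryGroup.LocalRing L v) w) < 1)
  have hs_dom : ∀ u ∈ s, ∀ w : PlacesOver L v, Valued.v ((u.1 : UnitaryGroup.LocalRing L v) w) < 1 := fun u hu => (Finset.mem_filter.1 hu).2
  have hs_out : ∀ u ∈ s, Quotient.out (QuotientGroup.mk u : ((UnitaryGroup.LocalRing L v)ˣ × ↥(normOneUnits (conjLocal L (IsCMField.complexConj L) v))) ⧸ C) = u := by
    intro u hu
    obtain ⟨q, -, rfl⟩ := Finset.mem_image.1 (Finset.mem_filter.1 hu).1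
    rw [QuotientGroup.out_eq']
  -- `F` is constant on cosets: `m ∈ u • C ⇒ F m = F u`
  have hcoset : ∀ {u m : ((UnitaryGroup.LocalRing L v)ˣ × ↥(normOneUnits (conjLocal L (IsCMField.complexConj L) v)))}, m ∈ u • (C : Set ((UnitaryGroup.LocalRing L v)ˣ × ↥(normOneUnits (conjLocal L (IsCMField.complexConj L) v)))) → F m = F u := by
    rintro u m ⟨c, hc, rfl⟩
    exact hFC u c hc
  -- KEY: the dominant case
  have hdom : ∀ m : ((UnitaryGroup.LocalRing L v)ˣ × ↥(normOneUnits (conjLocal L (IsCMField.complexConj L) v))), (∀ w : PlacesOver L v, Valued.v ((m.1 : UnitaryGroup.LocalRing L v) w) < 1) →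
      F m = ∑ u ∈ s, F u * ((u • (C : Set ((UnitaryGroup.LocalRing L v)ˣ × ↥(normOneUnits (conjLocal L (IsCMField.complexConj L) v))))).indicator (fun _ => (1 : ℂ)) m + (u • (C : Set ((UnitaryGroup.LocalRing L v)ˣ × ↥(normOneUnits (conjLocal L (IsCMField.complexConj L) v))))).indicator (fun _ => (1 : ℂ)) ((fun p : ((UnitaryGroup.LocalRing L v)ˣ × ↥(normOneUnits (conjLocal L (IsCMField.complexConj L) v))) => ((Units.map ((conjLocal L (IsCMField.complexConj L) v : UnitaryGroup.LocalRing L v →+* UnitaryGroup.LocalRing L v) : UnitaryGroup.LocalRing L v →* UnitaryGroup.LocalRing L v) p.1)⁻¹, p.2)) m)) := by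
    intro m hm
    -- the reflected indicators all vanish (ω m is not dominant)
    have hω0 : ∀ u ∈ s, (u • (C : Set ((UnitaryGroup.LocalRing L v)ˣ × ↥(normOneUnits (conjLocal L (IsCMField.complexConj L) v))))).indicator (fun _ => (1 : ℂ)) ((fun p : ((UnitaryGroup.LocalRing L v)ˣ × ↥(normOneUnits (conjLocal L (IsCMField.complexConj L) v))) => ((Units.map ((conjLocal L (IsCMField.complexConj L) v : UnitaryGroup.LocalRing L v →+* UnitaryGroup.LocalRing L v) : UnitaryGroup.LocalRing L v →* UnitaryGroup.LocalRing L v) p.1)⁻¹, p.2)) m) = 0 := by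
      intro u hu
      refine Set.indicator_of_notMem (fun h => ?_) _
      exact not_dominant_reflect_of_dominant L v hns hm ((dominant_iff_of_mem_smul L v hCle h).2 (hs_dom u hu))
    by_cases hmt : m ∈ ⋃ u ∈ t, u • (C : Set ((UnitaryGroup.LocalRing L v)ˣ × ↥(normOneUnits (conjLocal L (IsCMField.complexConj L) v))))
    · -- `m` lies in a covering coset: its class representative `u₀` is in `s` and carries the only non-zero term
      obtain ⟨u₁, hu₁, hmu₁⟩ := Set.mem_iUnion₂.1 hmt
      set u₀ : ((UnitaryGroup.LocalRing L v)ˣ × ↥(normOneUnits (conjLocal L (IsCMField.complexConj L) v))) := Quotient.out (QuotientGroup.mk m : ((UnitaryGroup.LocalRing L v)ˣ × ↥(normOneUnits (conjLocal L (IsCMField.complexConj L) v))) ⧸ C) with hu₀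
      have hmu₀ : m ∈ u₀ • (C : Set ((UnitaryGroup.LocalRing L v)ˣ × ↥(normOneUnits (conjLocal L (IsCMField.complexConj L) v)))) := mem_out_mk_smul L v C m
      have hu₀s : u₀ ∈ s := by
        refine Finset.mem_filter.2 ⟨Finset.mem_image.2 ⟨QuotientGroup.mk m, Finset.mem_image.2 ⟨u₁, hu₁, ?_⟩, rfl⟩,
          (dominant_iff_of_mem_smul L v hCle hmu₀).1 hm⟩
        exact (mem_smul_iff_mk_eq L v C u₁ m).1 hmu₁
      rw [Finset.sum_eq_single_of_mem u₀ hu₀s]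
      · rw [hω0 u₀ hu₀s, add_zero, Set.indicator_of_mem hmu₀, mul_one, hcoset hmu₀]
      · intro u hu hne
        have hnot : m ∉ u • (C : Set ((UnitaryGroup.LocalRing L v)ˣ × ↥(normOneUnits (conjLocal L (IsCMField.complexConj L) v)))) := fun h => hne (by
          rw [← hs_out u hu, (mem_smul_iff_mk_eq L v C u m).1 h])
        rw [hω0 u hu, add_zero, Set.indicator_of_notMem hnot, mul_zero]
    · -- `m` is outside every covering coset: `F m = 0` and every term vanishes
      have hFm : F m = 0 := image_eq_zero_of_notMem_tsupport fun h => hmt (ht h)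
      rw [hFm, eq_comm]
      refine Finset.sum_eq_zero fun u hu => ?_
      have hnot : m ∉ u • (C : Set ((UnitaryGroup.LocalRing L v)ˣ × ↥(normOneUnits (conjLocal L (IsCMField.complexConj L) v)))) := by
        intro h
        obtain ⟨q, hq, hqu⟩ := Finset.mem_image.1 (Finset.mem_filter.1 hu).1
        obtain ⟨u₁, hu₁, rfl⟩ := Finset.mem_image.1 hq
        refine hmt (Set.mem_iUnion₂.2 ⟨u₁, hu₁, ?_⟩)
        rw [mem_smul_iff_mk_eq] at h ⊢
        rw [← h, ← hqu, QuotientGroup.out_eq']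
      rw [hω0 u hu, add_zero, Set.indicator_of_notMem hnot, mul_zero]
  refine ⟨s, hs_dom, fun m => ?_⟩
  rcases dominant_or_mem_or_dominant_reflect L v hns m with hm | hm | hm
  · exact hdom m hm
  · -- `m ∈ M_c`: both sides vanish
    rw [hF0 m hm, eq_comm]
    refine Finset.sum_eq_zero fun u hu => ?_
    have h1 : m ∉ u • (C : Set ((UnitaryGroup.LocalRing L v)ˣ × ↥(normOneUnits (conjLocal L (IsCMField.complexConj L) v)))) := fun h => not_mem_of_dominant L v ((dominant_iff_of_mem_smul L v hCle h).2 (hs_dom u hu)) hm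
    have h2 : (fun p : ((UnitaryGroup.LocalRing L v)ˣ × ↥(normOneUnits (conjLocal L (IsCMField.complexConj L) v))) => ((Units.map ((conjLocal L (IsCMField.complexConj L) v : UnitaryGroup.LocalRing L v →+* UnitaryGroup.LocalRing L v) : UnitaryGroup.LocalRing L v →* UnitaryGroup.LocalRing L v) p.1)⁻¹, p.2)) m ∉ u • (C : Set ((UnitaryGroup.LocalRing L v)ˣ × ↥(normOneUnits (conjLocal L (IsCMField.complexConj L) v)))) := fun h =>
      not_mem_of_dominant L v ((dominant_iff_of_mem_smul L v hCle h).2 (hs_dom u hu)) (F0P3cStCharTSTorusCompactPart.reflect_mem_torusCompactPart L v hns m hm)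
    rw [Set.indicator_of_notMem h1, Set.indicator_of_notMem h2, add_zero, mul_zero]
  · -- `ω m` dominant: apply the dominant case to `ω m` and use the symmetry of `F` and of the summands
    rw [← hFω m, hdom ((fun p : ((UnitaryGroup.LocalRing L v)ˣ × ↥(normOneUnits (conjLocal L (IsCMField.complexConj L) v))) => ((Units.map ((conjLocal L (IsCMField.complexConj L) v : UnitaryGroup.LocalRing L v →+* UnitaryGroup.LocalRing L v) : UnitaryGroup.LocalRing L v →* UnitaryGroup.LocalRing L v) p.1)⁻¹, p.2)) m) hm]
    refine Finset.sum_congr rfl fun u _ => ?_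
    have hωω := F0P3cStCharTSTorusRay.reflect_reflect L v m
    simp only at hωω
    simp only [hωω]
    ring

/-! ## §2 ASSEMBLY: (SURJ) from the shell transforms -/

/-- `C_c^∞` is closed under scalar multiples (pointwise form). [cite: Rogawski1990, §1.6 p. 6] -/
theorem isLocSmooth_const_mul {X : Type*} [TopologicalSpace X] (a : ℂ) {φ : X → ℂ} (hφ : IsLocSmooth φ) : IsLocSmooth (fun x => a * φ x) :=
  ⟨hφ.1.comp (fun z => a * z), hφ.2.mul_left⟩

/-- **«SURJ-HECKE★» — (SURJ) FROM THE SHELL TRANSFORMS.**  Non-split `v`; ANY `Ftr`, `Ω`; `C : ℕ → Subgroup M` open subgroups inside `M_c` entering every neighbourhood of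
`1`.  IF (shell transforms) for every level `n` and every DOMINANT `u` there is a smooth `φ` supported in `Ω` with `Ftr φ = κ·(𝟙_{uC_n} + 𝟙_{uC_n}∘ω)`, `κ ≠ 0`, AND
(`hlin`) `Ftr` is additive-homogeneous on finite sums of smooth functions, THEN every smooth `ω`-symmetric `F : M → ℂ` vanishing on `M_c` is `Ftr φ` for a smooth `φ`
supported in `Ω` — the statement (SURJ) of ★ p849631.  Proof: (H3) ★ uniform local constancy gives a level `n` with `F` right-`C_n`-invariant; (H4) decomposes `F`;
`φ := Σ_u (F u ∕ κ_u)·φ_u`. [cite: Rogawski1990, §12.7 L. 12.7.1 (proof) p. 191; L. 12.7.2 (proof) p. 194] [cite: BernsteinZelevinsky1976, §1.1] -/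
theorem surj_of_shells (hns : ∀ w : PlacesOver L v, IsCMField.complexConj L • w.1 = w.1)
    (Ftr : (Gqs L v → ℂ) → ((UnitaryGroup.LocalRing L v)ˣ × ↥(normOneUnits (conjLocal L (IsCMField.complexConj L) v))) → ℂ) (Ω : Set (Gqs L v)) (C : ℕ → Subgroup ((UnitaryGroup.LocalRing L v)ˣ × ↥(normOneUnits (conjLocal L (IsCMField.complexConj L) v)))) (hCo : ∀ n, IsOpen (C n : Set ((UnitaryGroup.LocalRing L v)ˣ × ↥(normOneUnits (conjLocal L (IsCMField.complexConj L) v)))))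
    (hCle : ∀ n, C n ≤ (((Submonoid.pi Set.univ (fun w : PlacesOver L v => (w.1.adicCompletionIntegers L).toSubring.toSubmonoid)).units.prod (⊤ : Subgroup ↥(normOneUnits (conjLocal L (IsCMField.complexConj L) v)))) : Subgroup ((UnitaryGroup.LocalRing L v)ˣ × ↥(normOneUnits (conjLocal L (IsCMField.complexConj L) v))))) (hCb : ∀ V ∈ 𝓝 (1 : ((UnitaryGroup.LocalRing L v)ˣ × ↥(normOneUnits (conjLocal L (IsCMField.complexConj L) v)))), ∃ n, (C n : Set ((UnitaryGroup.LocalRing L v)ˣ × ↥(normOneUnits (conjLocal L (IsCMField.complexConj L) v)))) ⊆ V)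
    (hshell : ∀ (n : ℕ) (u : ((UnitaryGroup.LocalRing L v)ˣ × ↥(normOneUnits (conjLocal L (IsCMField.complexConj L) v)))), (∀ w : PlacesOver L v, Valued.v ((u.1 : UnitaryGroup.LocalRing L v) w) < 1) →
      ∃ φ : Gqs L v → ℂ, IsLocSmooth φ ∧ tsupport φ ⊆ Ω ∧ ∃ κ : ℂ, κ ≠ 0 ∧
        Ftr φ = fun m => κ * ((u • (C n : Set ((UnitaryGroup.LocalRing L v)ˣ × ↥(normOneUnits (conjLocal L (IsCMField.complexConj L) v))))).indicator (fun _ => (1 : ℂ)) m + (u • (C n : Set ((UnitaryGroup.LocalRing L v)ˣ × ↥(normOneUnits (conjLocal L (IsCMField.complexConj L) v))))).indicator (fun _ => (1 : ℂ)) ((fun p : ((UnitaryGroup.LocalRing L v)ˣ × ↥(normOneUnits (conjLocal L (IsCMField.complexConj L) v))) => ((Units.map ((conjLocal L (IsCMField.complexConj L) v : UnitaryGroup.LocalRing L v →+* UnitaryGroup.LocalRing L v) : UnitaryGroup.LocalRing L v →* UnitaryGroup.LocalRing L v) p.1)⁻¹, p.2)) m)))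
    (hlin : ∀ (s : Finset ((UnitaryGroup.LocalRing L v)ˣ × ↥(normOneUnits (conjLocal L (IsCMField.complexConj L) v)))) (c : ((UnitaryGroup.LocalRing L v)ˣ × ↥(normOneUnits (conjLocal L (IsCMField.complexConj L) v))) → ℂ) (φ : ((UnitaryGroup.LocalRing L v)ˣ × ↥(normOneUnits (conjLocal L (IsCMField.complexConj L) v))) → Gqs L v → ℂ), (∀ u ∈ s, IsLocSmooth (φ u)) →
      Ftr (fun x => ∑ u ∈ s, c u * φ u x) = fun m => ∑ u ∈ s, c u * Ftr (φ u) m) :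
    ∀ F : ((UnitaryGroup.LocalRing L v)ˣ × ↥(normOneUnits (conjLocal L (IsCMField.complexConj L) v))) → ℂ, IsLocSmooth F → (∀ m : ((UnitaryGroup.LocalRing L v)ˣ × ↥(normOneUnits (conjLocal L (IsCMField.complexConj L) v))), F ((fun p : ((UnitaryGroup.LocalRing L v)ˣ × ↥(normOneUnits (conjLocal L (IsCMField.complexConj L) v))) => ((Units.map ((conjLocal L (IsCMField.complexConj L) v : UnitaryGroup.LocalRing L v →+* UnitaryGroup.LocalRing L v) : UnitaryGroup.LocalRing L v →* UnitaryGroup.LocalRing L v) p.1)⁻¹, p.2)) m) = F m) → (∀ m ∈ (((Submonoid.pi Set.univ (fun w : PlacesOver L v => (w.1.adicCompletionIntegers L).toSubring.toSubmonoid)).units.prod (⊤ : Subgroup ↥(normOneUnits (conjLocal L (IsCMField.complexConj L) v)))) : Subgroup ((UnitaryGroup.LocalRing L v)ˣ × ↥(normOneUnits (conjLocal L (IsCMField.complexConj L) v)))), F m = 0) →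
      ∃ φ : Gqs L v → ℂ, (IsLocSmooth φ ∧ tsupport φ ⊆ Ω) ∧ Ftr φ = F := by
  intro F hF hFω hF0
  classical
  -- (H3) a level `n` under which `F` is right-invariant
  obtain ⟨n, hn⟩ := Literature.Topology.exists_forall_mul_eq_of_hasCompactSupport_of_basis (K := fun n => (C n : Set ((UnitaryGroup.LocalRing L v)ˣ × ↥(normOneUnits (conjLocal L (IsCMField.complexConj L) v))))) hCb hF.1 hF.2
  -- (H4) the finite decomposition at level `n`
  obtain ⟨s, hs_dom, hdec⟩ := exists_finset_shell_decomposition L v hns (C n) (hCo n) (hCle n) hn hFω hF0 hF.2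
  -- the shell test functions
  choose φ hφs hφΩ κ hκ hφ using fun u : {u : ((UnitaryGroup.LocalRing L v)ˣ × ↥(normOneUnits (conjLocal L (IsCMField.complexConj L) v))) // ∀ w : PlacesOver L v, Valued.v ((u.1 : UnitaryGroup.LocalRing L v) w) < 1} => hshell n u.1 u.2
  -- extend the choices to all of `M` (junk off the dominant elements; only `u ∈ s` are used)
  let φ' : ((UnitaryGroup.LocalRing L v)ˣ × ↥(normOneUnits (conjLocal L (IsCMField.complexConj L) v))) → Gqs L v → ℂ := fun u => if h : ∀ w : PlacesOver L v, Valued.v ((u.1 : UnitaryGroup.LocalRing L v) w) < 1 then φ ⟨u, h⟩ else 0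
  let κ' : ((UnitaryGroup.LocalRing L v)ˣ × ↥(normOneUnits (conjLocal L (IsCMField.complexConj L) v))) → ℂ := fun u => if h : ∀ w : PlacesOver L v, Valued.v ((u.1 : UnitaryGroup.LocalRing L v) w) < 1 then κ ⟨u, h⟩ else 1
  have hφ'u : ∀ (u : ((UnitaryGroup.LocalRing L v)ˣ × ↥(normOneUnits (conjLocal L (IsCMField.complexConj L) v)))) (hu : u ∈ s), φ' u = φ ⟨u, hs_dom u hu⟩ := fun u hu => dif_pos (hs_dom u hu)
  have hκ'u : ∀ (u : ((UnitaryGroup.LocalRing L v)ˣ × ↥(normOneUnits (conjLocal L (IsCMField.complexConj L) v)))) (hu : u ∈ s), κ' u = κ ⟨u, hs_dom u hu⟩ := fun u hu => dif_pos (hs_dom u hu)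
  refine ⟨fun x => ∑ u ∈ s, (F u / κ' u) * φ' u x, ⟨?_, ?_⟩, ?_⟩
  · -- smooth
    have h : (fun x => ∑ u ∈ s, (F u / κ' u) * φ' u x) = ∑ u ∈ s, (fun x => (F u / κ' u) * φ' u x) := by
      funext x; simp only [Finset.sum_apply]
    rw [h]
    exact IsLocSmooth.finset_sum s fun u hu => by rw [hφ'u u hu]; exact isLocSmooth_const_mul _ (hφs _)
  · -- supported in `Ω`
    have hsup : Function.support (fun x => ∑ u ∈ s, (F u / κ' u) * φ' u x) ⊆ ⋃ u ∈ s, tsupport (φ' u) := by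
      intro x hx
      obtain ⟨u, hu, hne⟩ := Finset.exists_ne_zero_of_sum_ne_zero hx
      exact Set.mem_iUnion₂.2 ⟨u, hu, subset_tsupport _ (right_ne_zero_of_mul hne)⟩
    have hclosed : IsClosed (⋃ u ∈ s, tsupport (φ' u)) := isClosed_biUnion_finset fun u _ => isClosed_tsupport _
    refine (closure_minimal hsup hclosed).trans (Set.iUnion₂_subset fun u hu => ?_)
    rw [hφ'u u hu]
    exact hφΩ _
  · -- the transform
    rw [hlin s (fun u => F u / κ' u) φ' (fun u hu => by rw [hφ'u u hu]; exact hφs _)]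
    funext m
    rw [hdec m]
    refine Finset.sum_congr rfl fun u hu => ?_
    rw [hφ'u u hu, hκ'u u hu, hφ]
    field_simp [hκ ⟨u, hs_dom u hu⟩]

/-- **(SHF′) FROM THE SHELL TRANSFORMS**: `surj_of_shells` + ★ p849631 `shf_of_surj` — the (SHF′) conjunct of the (TOR) package (★ p849458, VERBATIM) for ANY pinned
`toC`. [cite: Rogawski1990, §12.7 L. 12.7.1 (proof) p. 191; L. 12.7.2 (proof) pp. 193–194] -/
theorem shf_of_shells (hns : ∀ w : PlacesOver L v, IsCMField.complexConj L • w.1 = w.1)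
    (Ftr : (Gqs L v → ℂ) → ((UnitaryGroup.LocalRing L v)ˣ × ↥(normOneUnits (conjLocal L (IsCMField.complexConj L) v))) → ℂ) (Ω : Set (Gqs L v)) (toC : (((UnitaryGroup.LocalRing L v)ˣ →* ℂˣ) × (↥(normOneUnits (conjLocal L (IsCMField.complexConj L) v)) →* ℂˣ)) → (((UnitaryGroup.LocalRing L v)ˣ × ↥(normOneUnits (conjLocal L (IsCMField.complexConj L) v))) →* ℂˣ)) (htoC : (∀ (χ : (((UnitaryGroup.LocalRing L v)ˣ →* ℂˣ) × (↥(normOneUnits (conjLocal L (IsCMField.complexConj L) v)) →* ℂˣ))) (m : ((UnitaryGroup.LocalRing L v)ˣ × ↥(normOneUnits (conjLocal L (IsCMField.complexConj L) v)))), toC χ m = χ.1 m.1 * χ.2 m.2))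
    (C : ℕ → Subgroup ((UnitaryGroup.LocalRing L v)ˣ × ↥(normOneUnits (conjLocal L (IsCMField.complexConj L) v)))) (hCo : ∀ n, IsOpen (C n : Set ((UnitaryGroup.LocalRing L v)ˣ × ↥(normOneUnits (conjLocal L (IsCMField.complexConj L) v)))))
    (hCle : ∀ n, C n ≤ (((Submonoid.pi Set.univ (fun w : PlacesOver L v => (w.1.adicCompletionIntegers L).toSubring.toSubmonoid)).units.prod (⊤ : Subgroup ↥(normOneUnits (conjLocal L (IsCMField.complexConj L) v)))) : Subgroup ((UnitaryGroup.LocalRing L v)ˣ × ↥(normOneUnits (conjLocal L (IsCMField.complexConj L) v))))) (hCb : ∀ V ∈ 𝓝 (1 : ((UnitaryGroup.LocalRing L v)ˣ × ↥(normOneUnits (conjLocal L (IsCMField.complexConj L) v)))), ∃ n, (C n : Set ((UnitaryGroup.LocalRing L v)ˣ × ↥(normOneUnits (conjLocal L (IsCMField.complexConj L) v)))) ⊆ V)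
    (hshell : ∀ (n : ℕ) (u : ((UnitaryGroup.LocalRing L v)ˣ × ↥(normOneUnits (conjLocal L (IsCMField.complexConj L) v)))), (∀ w : PlacesOver L v, Valued.v ((u.1 : UnitaryGroup.LocalRing L v) w) < 1) →
      ∃ φ : Gqs L v → ℂ, IsLocSmooth φ ∧ tsupport φ ⊆ Ω ∧ ∃ κ : ℂ, κ ≠ 0 ∧
        Ftr φ = fun m => κ * ((u • (C n : Set ((UnitaryGroup.LocalRing L v)ˣ × ↥(normOneUnits (conjLocal L (IsCMField.complexConj L) v))))).indicator (fun _ => (1 : ℂ)) m + (u • (C n : Set ((UnitaryGroup.LocalRing L v)ˣ × ↥(normOneUnits (conjLocal L (IsCMField.complexConj L) v))))).indicator (fun _ => (1 : ℂ)) ((fun p : ((UnitaryGroup.LocalRing L v)ˣ × ↥(normOneUnits (conjLocal L (IsCMField.complexConj L) v))) => ((Units.map ((conjLocal L (IsCMField.complexConj L) v : UnitaryGroup.LocalRing L v →+* UnitaryGroup.LocalRing L v) : UnitaryGroup.LocalRing L v →* UnitaryGroup.LocalRing L v) p.1)⁻¹, p.2)) m)))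
    (hlin : ∀ (s : Finset ((UnitaryGroup.LocalRing L v)ˣ × ↥(normOneUnits (conjLocal L (IsCMField.complexConj L) v)))) (c : ((UnitaryGroup.LocalRing L v)ˣ × ↥(normOneUnits (conjLocal L (IsCMField.complexConj L) v))) → ℂ) (φ : ((UnitaryGroup.LocalRing L v)ˣ × ↥(normOneUnits (conjLocal L (IsCMField.complexConj L) v))) → Gqs L v → ℂ), (∀ u ∈ s, IsLocSmooth (φ u)) →
      Ftr (fun x => ∑ u ∈ s, c u * φ u x) = fun m => ∑ u ∈ s, c u * Ftr (φ u) m) :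
    (∀ χ : (((UnitaryGroup.LocalRing L v)ˣ →* ℂˣ) × (↥(normOneUnits (conjLocal L (IsCMField.complexConj L) v)) →* ℂˣ)), Continuous χ.1 → Continuous χ.2 → ∀ (j : Bool) (m₀ : ((UnitaryGroup.LocalRing L v)ˣ × ↥(normOneUnits (conjLocal L (IsCMField.complexConj L) v)))), m₀ ∉ ((Submonoid.pi Set.univ (fun w : PlacesOver L v => (w.1.adicCompletionIntegers L).toSubring.toSubmonoid)).units.prod (⊤ : Subgroup ↥(normOneUnits (conjLocal L (IsCMField.complexConj L) v)))) → ∃ φ : Gqs L v → ℂ, (IsLocSmooth φ ∧ tsupport φ ⊆ Ω) ∧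
            Ftr φ = fun m => ((m₀ • ((((Submonoid.pi Set.univ (fun w : PlacesOver L v => (w.1.adicCompletionIntegers L).toSubring.toSubmonoid)).units.prod (⊤ : Subgroup ↥(normOneUnits (conjLocal L (IsCMField.complexConj L) v)))) : Subgroup ((UnitaryGroup.LocalRing L v)ˣ × ↥(normOneUnits (conjLocal L (IsCMField.complexConj L) v)))) : Set ((UnitaryGroup.LocalRing L v)ˣ × ↥(normOneUnits (conjLocal L (IsCMField.complexConj L) v))))).indicator (fun m => (((toC (cond j (conjInvChar (conjLocal L (IsCMField.complexConj L) v) χ.1, χ.2) χ)) m₀ : ℂˣ) : ℂ) * ((((toC (cond j (conjInvChar (conjLocal L (IsCMField.complexConj L) v) χ.1, χ.2) χ)) m)⁻¹ : ℂˣ) : ℂ)) m) + ((m₀ • ((((Submonoid.pi Set.univ (fun w : PlacesOver L v => (w.1.adicCompletionIntegers L).toSubring.toSubmonoid)).units.prod (⊤ : Subgroup ↥(normOneUnits (conjLocal L (IsCMField.complexConj L) v)))) : Subgroup ((UnitaryGroup.LocalRing L v)ˣ × ↥(normOneUnits (conjLocal L (IsCMField.complexConj L) v)))) : Set ((UnitaryGroup.LocalRing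 L v)ˣ × ↥(normOneUnits (conjLocal L (IsCMField.complexConj L) v))))).indicator (fun m => (((toC (cond j (conjInvChar (conjLocal L (IsCMField.complexConj L) v) χ.1, χ.2) χ)) m₀ : ℂˣ) : ℂ) * ((((toC (cond j (conjInvChar (conjLocal L (IsCMField.complexConj L) v) χ.1, χ.2) χ)) m)⁻¹ : ℂˣ) : ℂ)) ((Units.map ((conjLocal L (IsCMField.complexConj L) v : UnitaryGroup.LocalRing L v →+* UnitaryGroup.LocalRing L v) : UnitaryGroup.LocalRing L v →* UnitaryGroup.LocalRing L v) m.1)⁻¹, m.2))) :=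
  F0P3cStCharTSShfOfSurj.shf_of_surj L v hns Ftr Ω toC htoC (surj_of_shells L v hns Ftr Ω C hCo hCle hCb hshell hlin)

end Summit.HodgeConjecture.HodgeConjecture.Cruxes.H413.F0P3cStCharTSSurjHecke

end
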